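import Summits.BirchSwinnertonDyer.Rank1Residual.Supersingular.SurjSerreCertificateShape
import Summits.BirchSwinnertonDyer.Rank1Residual.Supersingular.LocalOddTorsionCountAt
import Summits.BirchSwinnertonDyer.Rank1Residual.Supersingular.PadicRootCensusNewton
import Literature.NumberTheory.EllipticCurves.Fouquet2025.CongruenceTransportAnyReduction
import Literature.NumberTheory.EllipticCurves.LocalTorsionMultiplicativeProofs
import Literature.NumberTheory.EllipticCurves.NoEverywhereGoodReductionRat
import Literature.NumberTheory.EllipticCurves.SupersingularDensitySerreFrobeniusProofs
import Literature.NumberTheory.EllipticCurves.ModularityVersionApProofs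
import Mathlib.Algebra.Polynomial.Reverse
import HarnessLib

/-!
# Route `KatoDescentTamePotSupersingular` (rung K8-t′, cell `bsd-potss`): KERNEL TOOLS for the per-row SEED records
# of the open core `TameLowerIntrinsicNonCM` (item stmt-BirchSwinnertonDyer-19618) — Fouquet's Ass. 2.9 (2)
# (`FouquetGenericAt`), Ass. 3.4 in Tate form (`Fouquet2025.Assumption34TateAt`), strict level compatibility
# (`FouquetLevelCompatibleAt`) and good ORDINARY reduction of the partner, all DECIDED from the literal
# a-invariants (a `--supports … --as helper` file; seat `bsd-potss-k8t-c2`, generation 9; TOOLS, nothing booked)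

The seed roads of the 19618 census (`SeedRowA/B` of the registered skeleton v5, and `SeedRowC` of
`…TameLowerFouquetRoadBCS.lean`) ask, per row `(W, G, p)`, for four DECIDABLE local data that no census record
has yet put in the kernel (the seed rows lived in TSV columns `ass29_2`, the R-05 re-screen and `seed_N`):

* §1 `mem_factorList_of_prime_dvd` — the support lemma: a prime dividing `∏ qᵉ` over a list of primes is listed;
* §2 `goodOrd_of_countPoints` — `GoodOrd G p` (good ORDINARY) from `p ∤ Δ` and the schema point count
  `#G̃(𝔽_p) = n`, `p ∤ p + 1 − n` (the cell's `SecondDescent.goodOrd_of_intModel` re-derived on this import closure);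
* §3 `fouquetLevelCompatibleAt_of_factorList` — `FouquetLevelCompatibleAt p W G` (every bad prime `q ≠ p` of `G`
  divides `N_W`) from the complete factorisation of `|Δ_min(G)|` and `q ∣ Δ_min(W)` at each of its primes `≠ p`
  (`p ∣ N ⟺` bad reduction `⟺ p ∣ Δ_min` on globally minimal models: `dvd_conductorNorm_iff_not_hasGoodReductionAtPrime`,
  `hasGoodReductionAtPrime_of_not_dvd`, `not_hasGoodReductionAtPrime_of_dvd_minimalDiscriminantInt`);
* §4 `assumption34TateAt_of_factorList` — `Assumption34TateAt p W` from the complete factorisation of `|Δ_min(W)|`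
  and, at each prime `q ≠ p` of it, ONE of: `q ∣ c₄` (then `q` is not multiplicative, AEC VII.5.1(b):
  `LocalTorsionMult.dvd_Δ_and_not_dvd_c₄_integralModelInt_of_mult`), or `qᵉ ∥ Δ` with `p ∤ e` (the Tate prime is
  ramified in `W[p]`), or `q ≠ 2 ∧ q ≢ 1 (mod p)` (clause (5)(b) is vacuous). The Kummer clause itself (a `q ≡ 1`
  unramified Steinberg prime) is not needed by any row of the present census and is not offered here;
* §5 `fouquetGenericAt_of_rootCensus` — **Fouquet's Ass. 2.9 (2) EXACTLY** (`ΨSq_p` has no root in `ℚ_p`, the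
  route predicate `FouquetGenericAt p W`, seat g4) from TWO Hensel root censuses with EMPTY certificate of the
  cell's kernel decider `RootCensusNewton.check₄` (b2b x10b): one on the integer list `l` of `preΨ'_p`
  (no root in `ℤ_p`) and one on the REFLECTED list `l.reverse` (no root of the reciprocal polynomial in `ℤ_p`,
  hence no root of `preΨ'_p` of negative valuation: `preΨ'(x) = x^N · rev(x⁻¹)`, `eval₂_reflect_mul_pow`);
  `ΨSq_p = (preΨ'_p)²` for odd `p` (`ΨSq_ofNat`). The `p = 5` instance `fouquetGenericAt_five_of_rootCensus` takes
  x10b's exact list `prePsi5Z` (`ofList_prePsi5Z`).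

ROUTE-FREE (gate lint `theses-cone`): this file imports no `Theses` module and not the route's `…Defs`; the two route
predicates it serves are concluded in their UNFOLDED form (`FouquetLevelCompatibleAt p W G` and `FouquetGenericAt p W` are
`def`s with exactly these bodies, so a record closes them by `exact`). Everything is a THEOREM (no definition, no named
fact, no `sorry`); the per-row `decide` obligations are the
factorisation `|Δ| = ∏ qᵉ`, primality of the listed `q`, the divisibility tests, the point count, and the two
`check₄ … [] = true`. HONEST LABEL: tools; the items are NOT closed; nothing is booked; BSD is not proved by any
of this.

References: [Fouquet2025EquivariantTNC] Ass. 2.9 (p. 15), Ass. 3.4 (pp. 22–23), §2.4.1; [SilvermanAEC2009] III.1,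
VII.1 Rem. 1.1, VII.5 Prop. 5.1, Ex. 3.7; [Silverman1994] Lemma V.5.1; [DiamondShurman2005] §8.3 (p. 353);
Hensel's lemma (Mathlib).
-/

set_option autoImplicit false
-- sibling precedent (`KatoDescentTamePotSupersingularTameLowerVisibilityNn.lean`): the directory name repeats the summit name
set_option linter.dupNamespace false

noncomputable section

open scoped Classical
open Polynomial WeierstrassCurve Literature.NumberTheory.EllipticCurves
  Literature.NumberTheory.EllipticCurves.Rank1Residual
  Literature.NumberTheory.EllipticCurves.Rank1Residual.X11RankOneCertificates
  Summit.BirchSwinnertonDyer.BirchSwinnertonDyer.Rank1Residual.IntModel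
  Summit.BirchSwinnertonDyer.BirchSwinnertonDyer.Rank1Residual.X11RankOne
  Summit.BirchSwinnertonDyer.Rank1Residual.X11b
  Summit.BirchSwinnertonDyer.Rank1Residual.GaloisImage.RootCensus
  Summit.BirchSwinnertonDyer.Rank1Residual.Supersingular.RootCensusNewton
  Summit.BirchSwinnertonDyer.Rank1Residual.Supersingular.LocalOddTorsion
  Summit.BirchSwinnertonDyer.Rank1Residual.Supersingular

namespace Summit.BirchSwinnertonDyer.BirchSwinnertonDyer.Theorems.KTSeedRec

/-! ## §1 The support lemma -/

/-- **A prime dividing `∏_{(q,e) ∈ F} qᵉ` over a list of primes is one of the listed primes.** [folklore] -/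
theorem mem_factorList_of_prime_dvd (F : List (ℕ × ℕ)) (hpr : ∀ qe ∈ F, qe.1.Prime) {q : ℕ} (hq : q.Prime)
    (hqn : q ∣ (F.map fun qe => qe.1 ^ qe.2).prod) : ∃ qe ∈ F, qe.1 = q := by
  obtain ⟨x, hx, hqx⟩ := ((Nat.prime_iff.mp hq).dvd_prod_iff).mp hqn
  obtain ⟨qe, hqe, rfl⟩ := List.mem_map.mp hx
  exact ⟨qe, hqe, ((Nat.prime_dvd_prime_iff_eq hq (hpr qe hqe)).mp (hq.dvd_of_dvd_pow hqx)).symm⟩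

/-- From the kernel factorisation `|Δ(E₀)| = ∏ qᵉ`: a prime dividing `Δ(E₀)` is listed. [folklore] -/
theorem mem_factorList_of_prime_dvd_Δ {E₀ : WeierstrassCurve ℤ} (F : List (ℕ × ℕ))
    (hpr : ∀ qe ∈ F, qe.1.Prime) (hF : E₀.Δ.natAbs = (F.map fun qe => qe.1 ^ qe.2).prod) {q : ℕ} (hq : q.Prime)
    (hqΔ : (q : ℤ) ∣ E₀.Δ) : ∃ qe ∈ F, qe.1 = q :=
  mem_factorList_of_prime_dvd F hpr hq (by rw [← hF]; exact Int.natCast_dvd.mp hqΔ)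

/-! ## §2 Good ORDINARY reduction of a literal equation from a point count -/

/-- **`GoodOrd ⟨a₁,…,a₆⟩ p` from the integer data** (`p` odd, the equation globally minimal): `p ∤ Δ` (good
reduction, AEC VII.5.1(a)) and the schema count `countPoints [a] p = n` with `p ∤ p + 1 − n` (`a_p ≢ 0`,
ordinary). [cite: SilvermanAEC2009, VII.5 Prop. 5.1(a)] -/
theorem goodOrd_of_countPoints (a1 a2 a3 a4 a6 : ℤ) (p : ℕ) [Fact p.Prime] (hp2 : p ≠ 2)
    [hmin : (⟨a1, a2, a3, a4, a6⟩ : WeierstrassCurve ℚ).IsGloballyMinimal]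
    (hΔ : ¬ (p : ℤ) ∣ discOf [a1, a2, a3, a4, a6]) {n : ℕ} (hc : countPoints [a1, a2, a3, a4, a6] p = n)
    (hap : ¬ (p : ℤ) ∣ (p : ℤ) + 1 - n) : GoodOrd (⟨a1, a2, a3, a4, a6⟩ : WeierstrassCurve ℚ) p := by
  have hI : integralModelInt (⟨a1, a2, a3, a4, a6⟩ : WeierstrassCurve ℚ) = ⟨a1, a2, a3, a4, a6⟩ :=
    integralModelInt_eq_of_map_eq _ (map_mk_int a1 a2 a3 a4 a6)
  refine ⟨hasGoodReductionAtPrime_of_not_dvd _ p ?_, ?_⟩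
  · rw [minimalDiscriminantInt_eq hI, intCurve_Δ]; exact hΔ
  · rw [frobeniusTrace_eq hI (natCard_point_eq_of_countPoints a1 a2 a3 a4 a6 p hp2 hΔ hc)]; exact hap

/-! ## §3 Strict level compatibility from the two discriminant supports -/

/-- **`FouquetLevelCompatibleAt p W G` (unfolded: every prime `q ≠ p` dividing `N_G` divides `N_W`) from factor lists**: with `E_W = integralModelInt W`, `E_G = integralModelInt G`,
the complete factorisation `|Δ(E_G)| = ∏ qᵉ` over primes, and at every listed `q` either `q = p` or `q ∣ Δ(E_W)`:
every prime `q ≠ p` with `q ∣ N_G` is bad for `G`, divides `Δ_min(G)`, is listed, divides `Δ_min(W)`, is bad for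
`W`, divides `N_W`. [cite: Fouquet2025EquivariantTNC, §2.4.1 (p. 15)] [cite: DiamondShurman2005, §8.3 (PDF p. 353)]
[cite: SilvermanAEC2009, VII.5 Prop. 5.1(a)] -/
theorem fouquetLevelCompatibleAt_of_factorList (p : ℕ) [Fact p.Prime] {W G : WeierstrassCurve ℚ} [W.IsElliptic]
    [W.IsGloballyMinimal] [G.IsElliptic] [G.IsGloballyMinimal] {EW EG : WeierstrassCurve ℤ}
    (hIW : integralModelInt W = EW) (hIG : integralModelInt G = EG) (FG : List (ℕ × ℕ))
    (hpr : ∀ qe ∈ FG, qe.1.Prime) (hFG : EG.Δ.natAbs = (FG.map fun qe => qe.1 ^ qe.2).prod)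
    (hsub : ∀ qe ∈ FG, qe.1 = p ∨ (qe.1 : ℤ) ∣ EW.Δ) :
    ∀ q : ℕ, q.Prime → q ≠ p → (q : ℤ) ∣ G.conductorNorm ℤ → (q : ℤ) ∣ W.conductorNorm ℤ := by
  intro q hq hqp hqNG
  haveI : Fact q.Prime := ⟨hq⟩
  have hbadG : ¬ G.HasGoodReductionAtPrime q :=
    (G.dvd_conductorNorm_iff_not_hasGoodReductionAtPrime q).mp (Int.natCast_dvd_natCast.mp hqNG)
  have hqΔG : (q : ℤ) ∣ EG.Δ := by
    rw [← minimalDiscriminantInt_eq hIG]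
    exact G.natCast_dvd_minimalDiscriminantInt_of_not_hasGoodReductionAtPrime q hbadG
  obtain ⟨qe, hqe, hqeq⟩ := mem_factorList_of_prime_dvd_Δ FG hpr hFG hq hqΔG
  rcases hsub qe hqe with h | h
  · exact absurd (hqeq.symm.trans h) hqp
  · rw [hqeq] at h
    have hbadW : ¬ W.HasGoodReductionAtPrime q :=
      W.not_hasGoodReductionAtPrime_of_dvd_minimalDiscriminantInt q (by rw [minimalDiscriminantInt_eq hIW]; exact h)
    exact Int.natCast_dvd_natCast.mpr ((W.dvd_conductorNorm_iff_not_hasGoodReductionAtPrime q).mpr hbadW)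

/-! ## §4 Fouquet's Ass. 3.4 in Tate form from the discriminant support -/

/-- **`Assumption34TateAt p W` from a factor list**, `E₀ = integralModelInt W`: the complete factorisation
`|Δ(E₀)| = ∏ qᵉ` over primes and, at each listed `q`, one of — `q = p`; `q ∣ c₄(E₀)` (so `q` is NOT a
multiplicative prime, AEC VII.5.1(b)); `qᵉ ∥ Δ(E₀)` with (`p ∤ e` — `W[p]` is ramified at the Tate prime `q`, no
condition — or `q ≠ 2 ∧ q % p ≠ 1` — clause (5)(b) vacuous). A multiplicative prime `q` divides `Δ_min = Δ(E₀)`,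
hence is listed; `v_q(Δ_min) = e` by `padicValInt_eq_of_dvd_of_not_dvd`. [cite: Fouquet2025EquivariantTNC, Ass. 3.4 (pp. 22–23)]
[cite: SilvermanAEC2009, VII.5 Prop. 5.1(b)] [cite: Silverman1994, Lemma V.5.1] -/
theorem assumption34TateAt_of_factorList (p : ℕ) [Fact p.Prime] {W : WeierstrassCurve ℚ} [W.IsElliptic]
    [W.IsGloballyMinimal] {E₀ : WeierstrassCurve ℤ} (hI : integralModelInt W = E₀) (F : List (ℕ × ℕ))
    (hpr : ∀ qe ∈ F, qe.1.Prime) (hF : E₀.Δ.natAbs = (F.map fun qe => qe.1 ^ qe.2).prod)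
    (hchk : ∀ qe ∈ F, qe.1 = p ∨ (qe.1 : ℤ) ∣ E₀.c₄ ∨
      ((qe.1 : ℤ) ^ qe.2 ∣ E₀.Δ ∧ ¬ (qe.1 : ℤ) ^ (qe.2 + 1) ∣ E₀.Δ ∧ (¬ p ∣ qe.2 ∨ (qe.1 ≠ 2 ∧ qe.1 % p ≠ 1)))) :
    Fouquet2025.Assumption34TateAt p W := by
  intro q _ hqp hmult hpv
  obtain ⟨hqΔ, hqc₄⟩ := LocalTorsionMult.dvd_Δ_and_not_dvd_c₄_integralModelInt_of_mult W q hmult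
  rw [hI] at hqΔ hqc₄
  obtain ⟨qe, hqe, hqeq⟩ := mem_factorList_of_prime_dvd_Δ F hpr hF (Fact.out : q.Prime) hqΔ
  rcases hchk qe hqe with h | h | ⟨hdvd, hndvd, h⟩
  · exact absurd (hqeq.symm.trans h) hqp
  · rw [hqeq] at h; exact absurd h hqc₄
  · rw [hqeq] at hdvd hndvd h
    have hv : padicValInt q W.minimalDiscriminantInt = qe.2 := by
      rw [show W.minimalDiscriminantInt = E₀.Δ from minimalDiscriminantInt_eq hI]
      exact padicValInt_eq_of_dvd_of_not_dvd q hdvd hndvd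
    rw [hv] at hpv
    rcases h with h | ⟨h2, h1⟩
    · exact absurd hpv h
    · exact ⟨h2, fun h1' => absurd h1' h1⟩

/-! ## §5 Fouquet's Ass. 2.9 (2) EXACTLY (`FouquetGenericAt`) from two Hensel root censuses -/

/-- The coefficients of `ofList l` are the list entries (`0` beyond the length). [folklore] -/
theorem coeff_ofList : ∀ (l : List ℤ) (i : ℕ), (ofList l).coeff i = l.getD i 0
  | [], i => by simp [ofList]
  | c :: l, 0 => by simp [ofList]
  | c :: l, i + 1 => by
    rw [ofList, coeff_add, coeff_C_succ, coeff_X_mul, zero_add, coeff_ofList l i]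
    simp

/-- `natDegree (ofList l) ≤ l.length - 1`. [folklore] -/
theorem natDegree_ofList_le (l : List ℤ) : (ofList l).natDegree ≤ l.length - 1 := by
  rw [natDegree_le_iff_coeff_eq_zero]
  intro i hi
  rw [coeff_ofList, List.getD_eq_getElem?_getD, List.getElem?_eq_none (by omega)]
  rfl

/-- **The reversed coefficient list is the reflected polynomial**: `ofList l.reverse = reflect (l.length − 1) (ofList l)`.
[folklore] -/
theorem ofList_reverse_eq_reflect (l : List ℤ) : ofList l.reverse = (ofList l).reflect (l.length - 1) := by
  ext i
  rw [coeff_reflect, coeff_ofList, coeff_ofList, List.getD_eq_getElem?_getD, List.getD_eq_getElem?_getD]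
  by_cases hi : i < l.length
  · rw [List.getElem?_reverse hi, revAt_le (by omega)]
  · rw [List.getElem?_eq_none (by rw [List.length_reverse]; omega), List.getElem?_eq_none]
    have : l.length - 1 < i ∨ (l.length = 0 ∧ i = 0) := by omega
    rcases this with h | ⟨h, hi0⟩
    · rw [revAt_eq_self_of_lt h]; omega
    · rw [h, hi0]; simp

/-- The literal rational equation over `ℚ_p` is the literal integer equation read along `ℤ → ℚ_p`. [folklore] -/
theorem baseChange_padic_eq_map (p : ℕ) [Fact p.Prime] (a1 a2 a3 a4 a6 : ℤ) :
    (⟨a1, a2, a3, a4, a6⟩ : WeierstrassCurve ℚ).baseChange ℚ_[p] =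
      (⟨a1, a2, a3, a4, a6⟩ : WeierstrassCurve ℤ).map (algebraMap ℤ ℚ_[p]) := by
  ext <;> simp [WeierstrassCurve.baseChange, WeierstrassCurve.map]

/-- **`FouquetGenericAt p ⟨a₁,…,a₆⟩` UNFOLDED (Ass. 2.9 (2) exactly: `ΨSq_p` has no root in `ℚ_p`) from two root censuses**,
`p` an odd prime: `l` an integer list with `ofList l = preΨ'_p(E₀)`, `check₄ p l k₁ [] = true` (no root of `preΨ'_p` in
`ℤ_p`, `RootCensusNewton.exists_roots_of_check₄` with the empty certificate) and `check₄ p l.reverse k₂ [] = true` (no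
root of the reciprocal polynomial in `ℤ_p`; a root `x` of `preΨ'_p` with `‖x‖ > 1` would give the root `x⁻¹ ∈ ℤ_p` of
it, `eval₂_reflect_mul_pow`); and `ΨSq_p = (preΨ'_p)²` for odd `p`. [cite: Fouquet2025EquivariantTNC, Ass. 2.9 (p. 15)]
[cite: SilvermanAEC2009, Exercise 3.7 (d)] -/
theorem fouquetGenericAt_of_rootCensus (p : ℕ) [hp : Fact p.Prime] (hp2 : p ≠ 2) (a1 a2 a3 a4 a6 : ℤ)
    (l : List ℤ) (hl : ofList l = (⟨a1, a2, a3, a4, a6⟩ : WeierstrassCurve ℤ).preΨ' p) (k₁ k₂ : ℕ)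
    (h₁ : check₄ p l k₁ [] = true) (h₂ : check₄ p l.reverse k₂ [] = true) :
    ∀ x : ℚ_[p], (((⟨a1, a2, a3, a4, a6⟩ : WeierstrassCurve ℚ).baseChange ℚ_[p]).ΨSq (p : ℤ)).eval x ≠ 0 := by
  intro x hx
  -- `ΨSq_p(x) = preΨ'_p(x)² · 1` for odd `p`
  have hodd : ¬ Even (p : ℕ) := fun h => hp2 (hp.out.even_iff.mp h)
  rw [show ((p : ℤ)) = ((p : ℕ) : ℤ) from rfl, WeierstrassCurve.ΨSq_ofNat, if_neg hodd, mul_one, eval_pow] at hx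
  have hx' : (((⟨a1, a2, a3, a4, a6⟩ : WeierstrassCurve ℚ).baseChange ℚ_[p]).preΨ' p).eval x = 0 := pow_eq_zero_iff
    (two_ne_zero) |>.mp hx
  rw [baseChange_padic_eq_map, ← aeval_ofList_eq_eval_preΨ' hl] at hx'
  -- no roots at all from the two censuses
  obtain ⟨_, _, _, hnone₁⟩ := exists_roots_of_check₄ (p := p) l k₁ [] h₁
  obtain ⟨_, _, _, hnone₂⟩ := exists_roots_of_check₄ (p := p) l.reverse k₂ [] h₂
  by_cases hxi : ‖x‖ ≤ 1
  · -- integral root: census 1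
    obtain ⟨i, _⟩ := hnone₁ ⟨x, hxi⟩ (by
      have h := coe_aeval_ofList (p := p) l ⟨x, hxi⟩
      rw [show ((⟨x, hxi⟩ : ℤ_[p]) : ℚ_[p]) = x from rfl, hx'] at h
      exact PadicInt.coe_eq_zero.mp h)
    exact i.elim0
  · -- non-integral root: `t = x⁻¹ ∈ ℤ_p` is a root of the reflected polynomial: census 2
    have hx0 : x ≠ 0 := fun h => hxi (by rw [h, norm_zero]; exact zero_le_one)
    have hnx : 1 < ‖x‖ := lt_of_not_ge hxi
    have ht : ‖x⁻¹‖ ≤ 1 := by rw [norm_inv]; exact inv_le_one_of_one_le₀ hnx.le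
    letI : Invertible x := invertibleOfNonzero hx0
    have hrefl := eval₂_reflect_mul_pow (algebraMap ℤ ℚ_[p]) x (l.length - 1) (ofList l) (natDegree_ofList_le l)
    rw [← ofList_reverse_eq_reflect, ← aeval_def, ← aeval_def, hx', mul_eq_zero] at hrefl
    have hroot : aeval (⅟x) (ofList l.reverse) = 0 := by
      rcases hrefl with h | h
      · exact h
      · exact absurd (pow_eq_zero_iff (by
          intro h0
          rw [h0, pow_zero] at h
          exact one_ne_zero h) |>.mp h) hx0
    rw [invOf_eq_inv] at hroot
    obtain ⟨i, _⟩ := hnone₂ ⟨x⁻¹, ht⟩ (by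
      have h := coe_aeval_ofList (p := p) l.reverse ⟨x⁻¹, ht⟩
      rw [show ((⟨x⁻¹, ht⟩ : ℤ_[p]) : ℚ_[p]) = x⁻¹ from rfl, hroot] at h
      exact PadicInt.coe_eq_zero.mp h)
    exact i.elim0

/-- **`FouquetGenericAt 5 ⟨a₁,…,a₆⟩` UNFOLDED, from two root censuses on x10b's exact list `prePsi5Z`** (`ofList_prePsi5Z`):
the shape the census records `decide`. [cite: Fouquet2025EquivariantTNC, Ass. 2.9 (p. 15)] [cite: SilvermanAEC2009, Exercise 3.7 (d)] -/
theorem fouquetGenericAt_five_of_rootCensus (a1 a2 a3 a4 a6 : ℤ) (k₁ k₂ : ℕ)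
    (h₁ : check₄ 5 (prePsi5Z ⟨a1, a2, a3, a4, a6⟩) k₁ [] = true)
    (h₂ : check₄ 5 (prePsi5Z ⟨a1, a2, a3, a4, a6⟩).reverse k₂ [] = true) :
    haveI : Fact (Nat.Prime 5) := ⟨by norm_num⟩
    ∀ x : ℚ_[5], (((⟨a1, a2, a3, a4, a6⟩ : WeierstrassCurve ℚ).baseChange ℚ_[5]).ΨSq (5 : ℤ)).eval x ≠ 0 :=
  haveI : Fact (Nat.Prime 5) := ⟨by norm_num⟩
  fouquetGenericAt_of_rootCensus 5 (by norm_num) a1 a2 a3 a4 a6 _ ofList_prePsi5Z k₁ k₂ h₁ h₂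

end Summit.BirchSwinnertonDyer.BirchSwinnertonDyer.Theorems.KTSeedRec

end
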